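import Summits.HodgeConjecture.HodgeConjecture.Theorems.H413E2SWSplitPlaceFrame
import HarnessLib

/-!
# H413 · E-2 · SW2 (iii) — THE SPLIT-PLACE LETTERS `e, T, hfib, hTh, hTS, hTe` INSTANTIATED for the unitary dual pair

Cell `hodgecm-mathlib`, crux H413 (`stmt-HodgeConjecture-24833`), child line `Cruxes/H413/Lines/F0_E2SiegelWeilWeilRange.lean`,
`StubSW2` (iii); I-CLOSE sheet `F0/P4/F0P2a-p08/SW2-ICLOSE-ASSEMBLY.v0` §1 (BRIDGE-v).  PROOF lane, `--supports stmt-HodgeConjecture-24833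
--as helper`.  HC_CM is proved only modulo the 7 printed citations until rung 0 closes; nothing in this file is about Hodge classes.

The split-place producers of the I-CLOSE step (★ `Weil1965/AdelicSiegelFibreMeasureSplitPlace`, `…Weighted`, `FibreMeasureSplitPlace`,
the outer assembly `Theorems/H413E2SWIdentityClose*`) are written against LETTERS: a homeomorphism
`e : X□(𝔸_F) ≃ₜ (X_v × Y_v) × Y`, a family `T : GL κ K → (X□(𝔸_F) ≃ₜ X□(𝔸_F))`, and the clauses `hfib` (on the fibre `h = b`,
`(e x).1.1 ⬝ᵥ (e x).1.2 = b′`), `hTh` (`h ∘ T g = h`), `hTS` (`T g` preserves `𝒮`), `hTe` (`e (T g x) = ((g (e x).1.1, (g⁻¹)ᵀ (e x).1.2), (e x).2)`),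
`hTμ`∕`hST` (invariance of the measure ∕ functional).  This file INSTANTIATES them for the E-2 dual pair at a finite place `v` with
`s² = d` in `F_v`: `K := F_v`, `κ := Fin n`, `Y := X□(𝔸_F)^{(v)} = AdelicVector.trivialAt`, `e := (β_v × id) ∘ placeSplitting⁻¹`
(★ p807976 + ★ p810752 `exists_splitPlaceFrame`), `T g := A_{h_g}` the geometric action of a `v`-supported `h_g ∈ U(J_V)(𝔸_F)` chosen
over ★ `exists_vSupported_realising`, `b′ := b` read in `F_v`:

* **`exists_splitPlaceLetters`** — `∃ β e T`, (1) `e x = (β x_v, (placeSplitting⁻¹ x).2)`; (2) `β` carries Haar to `c • (Haar ⊗ Haar)`;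
  (3) `hfib` (★ `evalAt_hNorm` through (E1)); (4) every `T g` IS some `A_h` — so `hTμ` and `hST` are the tree's invariance tokens for
  `A_h` (★ `map_fibreMeasure_thetaOrbitFunctionalReal_eq`, `thetaOrbitFunctionalReal_comp_vDiagAct`, `adelicSiegelFunctional_comp`);
  (5) `hTh` (★ `hNorm_vDiagAct`); (6) `hTS` (★ `twist_actTwistGL`, `twist_mem`); (7) `hTe` ((E3)(ii)+(iii) of ★ `exists_splitPlaceFrame`);
* **`exists_splitPlaceSelector`** — the same letters in SELECTOR form (`fr`, `sel : GL_n(F_v) → U(J_V)(𝔸_F)`, `hfix`,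
  `hTe : fr (A_{sel g} x) = ((g (fr x).1.1, (g⁻¹)ᵀ (fr x).1.2), (fr x).2)`), the binder shape of ★ `ThetaIntegralFibreMeasureSplitPlace`.

Weil (1965) n° 50: `X_A = X_v × X′`; at a split auxiliary place `U(i)_v ≅ GL(m, 𝔎_v)` acts on `X_v` through `(g, (g⁻¹)ᵀ)`.
References: A. Weil, *Acta Math.* 113 (1965), Chap. V n° 50, pp. 73–74 [Weil1965].
-/

set_option autoImplicit false
-- the cell's `Summit.HodgeConjecture.HodgeConjecture.…` namespace repeats the summit name by design (D-0017 layout)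
set_option linter.dupNamespace false

noncomputable section


namespace Summit.HodgeConjecture.HodgeConjecture.Cruxes.H413.E2SWSplitPlaceLetters

open scoped Matrix Kronecker NNReal ENNReal
open _root_.MeasureTheory NumberField IsDedekindDomain
open Literature.RepresentationTheory.HeisenbergGroup
open Literature.NumberTheory.Weil1964 Literature.NumberTheory.Weil1965 Literature.NumberTheory.Weil1965.UnitaryDoubling
open Literature.NumberTheory.Automorphic Literature.NumberTheory.Automorphic.UnitaryGroup
open Literature.NumberTheory.GelbartRogawski1991 Literature.NumberTheory.GelbartRogawski1991.UnitaryDualPair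
open Literature.NumberTheory.Automorphic.AdelicVector (evalAt evalAt_apply trivialAt placeSplitting)
open Summit.HodgeConjecture.HodgeConjecture.Cruxes.H413.E2SWSplitPlaceFrame

variable (F E : Type) [Field F] [NumberField F] [Field E] [NumberField E] [Algebra F E] [Algebra.IsQuadraticExtension F E]
  (c : E ≃ₐ[F] E) {δ : E} (hcδ : c δ = -δ) (hδ : δ ≠ 0) {d : F} (hd : δ * δ = algebraMap F E d)
  (N : ℕ) {n : ℕ} (e : Fin N × Fin 1 ≃ Fin n)
  (TV : Matrix (Fin N) (Fin N) F) (hV : TV.IsSymm) (hVd : IsUnit TV.det)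
  (TW : Matrix (Fin 1) (Fin 1) F) (hW : TW.IsSymm) (hWd : IsUnit TW.det)
  (v : HeightOneSpectrum (𝓞 F))

/-- a linear equivalence from a finite free module `K^m` onto a product of two such is a homeomorphism (all linear maps out of
`K^m`, `K^p`, `K^q` are continuous). [folklore] -/
private theorem continuous_linearEquiv_symm_prod {K : Type} [Field K] [TopologicalSpace K] [IsTopologicalRing K] {m p q : ℕ}
    (β : (Fin m → K) ≃ₗ[K] ((Fin p → K) × (Fin q → K))) : Continuous β.symm := by
  haveI : ContinuousSMul K K := ⟨continuous_mul⟩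
  have h1 : Continuous fun a : Fin p → K => β.symm.toLinearMap (LinearMap.inl K _ _ a) :=
    (β.symm.toLinearMap.comp (LinearMap.inl K _ _)).continuous_on_pi
  have h2 : Continuous fun b : Fin q → K => β.symm.toLinearMap (LinearMap.inr K _ _ b) :=
    (β.symm.toLinearMap.comp (LinearMap.inr K _ _)).continuous_on_pi
  have heq : (fun z : (Fin p → K) × (Fin q → K) => β.symm z) =
      fun z => β.symm.toLinearMap (LinearMap.inl K _ _ z.1) + β.symm.toLinearMap (LinearMap.inr K _ _ z.2) := by
    funext z
    rw [← map_add, LinearMap.inl_apply, LinearMap.inr_apply, Prod.mk_add_mk, add_zero, zero_add]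
    rfl
  have hc : Continuous fun z : (Fin p → K) × (Fin q → K) => β.symm z := by
    rw [heq]
    exact (h1.comp continuous_fst).add (h2.comp continuous_snd)
  exact hc

include hδ in
/-- **THE SPLIT-PLACE LETTERS `e, T, hfib, hTh, hTS, hTe` of the I-CLOSE producers, INSTANTIATED for the dual pair** — at a finite
place `v` with `s² = d` in `F_v`: the homeomorphism `e := (β_v × id) ∘ placeSplitting⁻¹ : X□(𝔸_F) ≃ₜ (X_v × Y_v) × X□(𝔸_F)^{(v)}`
(★ `AdelicVector.placeSplitting`, ★ `exists_splitPlaceFrame`), the family `T g` (`g ∈ GL_n(F_v)`) of geometric actions `A_h` of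
`v`-supported elements `h ∈ U(J_V)(𝔸_F)` (a choice over ★ `exists_vSupported_realising`), and their properties in the EXACT shapes of
the letters of ★ `AdelicSiegelFibreMeasureSplitPlace` ∕ `FibreMeasureSplitPlace` (`K := F_v`, `κ := Fin n`, `Y := trivialAt`,
`b′ := (b : F_v)`): (1) the formula for `e`; (2) `β_v` carries Haar to `c • (Haar ⊗ Haar)`; (3) `hfib`: on the fibre `hNorm = b`,
`(e x).1.1 ⬝ᵥ (e x).1.2 = b` (★ `evalAt_hNorm`); (4) each `T g` IS a geometric action `A_h` (so `hTμ`, `hST` are the tree's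
invariance tokens for `A_h`); (5) `hTh`: `hNorm ∘ T g = hNorm` (★ `hNorm_vDiagAct`); (6) `hTS`: `T g` preserves `𝒮(X□(𝔸_F))`
(★ `twist_actTwistGL`, `twist_mem`); (7) `hTe`: `e (T g x) = ((g (e x).1.1, (g⁻¹)ᵀ (e x).1.2), (e x).2)`.  Weil (1965) n° 50:
`X_A = X_v × X′`, `U(i)_v ≅ GL(m, 𝔎_v)` acting through `(g, g⁻ᵀ)`. [cite: Weil1965, Chap. V n° 50, pp. 73–74] -/
theorem exists_splitPlaceLetters {s : v.adicCompletion F} (hs : s * s = algebraMap F (v.adicCompletion F) d)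
    [MeasurableSpace (v.adicCompletion F)] [BorelSpace (v.adicCompletion F)]
    (μ : Measure (v.adicCompletion F)) [μ.IsAddHaarMeasure] :
    ∃ (β : (Fin (n + n) → v.adicCompletion F) ≃ₗ[v.adicCompletion F] ((Fin n → v.adicCompletion F) × (Fin n → v.adicCompletion F)))
      (eH : (Fin (n + n) → AdeleRing (𝓞 F) F) ≃ₜ
        ((Fin n → v.adicCompletion F) × (Fin n → v.adicCompletion F)) × trivialAt F (Fin (n + n)) v)
      (T : GL (Fin n) (v.adicCompletion F) → ((Fin (n + n) → AdeleRing (𝓞 F) F) ≃ₜ (Fin (n + n) → AdeleRing (𝓞 F) F))),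
      (∀ x, eH x = (β (evalAt F (Fin (n + n)) v x), ((placeSplitting F (Fin (n + n)) v).symm x).2)) ∧
      (∃ cst : ℝ≥0, 0 < cst ∧
        Measure.map β (Measure.pi fun _ : Fin (n + n) => μ) =
          (cst : ℝ≥0∞) • ((Measure.pi fun _ : Fin n => μ).prod (Measure.pi fun _ : Fin n => μ))) ∧
      (∀ (x : Fin (n + n) → AdeleRing (𝓞 F) F) (b : F),
        hNorm F E c hcδ hδ N e TV hVd TW hWd x = algebraMap F (AdeleRing (𝓞 F) F) b →
          (eH x).1.1 ⬝ᵥ (eH x).1.2 = (b : v.adicCompletion F)) ∧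
      (∀ g, ∃ h : UnitaryGroup.adelic F E c N (TV.map (algebraMap F E)),
        ⇑(T g) = ⇑(vDiagAct F E c hcδ hδ hd N e TV hV hVd TW hW hWd h)) ∧
      (∀ g x, hNorm F E c hcδ hδ N e TV hVd TW hWd (T g x) = hNorm F E c hcδ hδ N e TV hVd TW hWd x) ∧
      (∀ g, ∀ Φ ∈ piSchwartzBruhat F (Fin (n + n)), Φ ∘ ⇑(T g) ∈ piSchwartzBruhat F (Fin (n + n))) ∧
      (∀ g x, eH (T g x) =
        ((((g : Matrix (Fin n) (Fin n) (v.adicCompletion F)) *ᵥ (eH x).1.1,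
            ((g⁻¹ : GL (Fin n) (v.adicCompletion F)) : Matrix (Fin n) (Fin n) (v.adicCompletion F))ᵀ *ᵥ (eH x).1.2) :
              (Fin n → v.adicCompletion F) × (Fin n → v.adicCompletion F)), (eH x).2)) := by
  obtain ⟨β, hQ, hHaar, hreal⟩ := exists_splitPlaceFrame F E c hcδ hδ hd N e TV hV hVd TW hW hWd v hs μ
  choose sel hfix hii hsnd using hreal
  haveI : ContinuousSMul (v.adicCompletion F) (v.adicCompletion F) := ⟨continuous_mul⟩
  haveI : ContinuousSMul (AdeleRing (𝓞 F) F) (AdeleRing (𝓞 F) F) := ⟨continuous_mul⟩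
  -- `β` as a homeomorphism, `e := (β × id) ∘ placeSplitting⁻¹`
  let βH : (Fin (n + n) → v.adicCompletion F) ≃ₜ ((Fin n → v.adicCompletion F) × (Fin n → v.adicCompletion F)) :=
    { toEquiv := β.toEquiv
      continuous_toFun := β.toLinearMap.continuous_on_pi
      continuous_invFun := continuous_linearEquiv_symm_prod β }
  let eH : (Fin (n + n) → AdeleRing (𝓞 F) F) ≃ₜ
      ((Fin n → v.adicCompletion F) × (Fin n → v.adicCompletion F)) × trivialAt F (Fin (n + n)) v :=
    (placeSplitting F (Fin (n + n)) v).symm.toHomeomorph.trans (βH.prodCongr (Homeomorph.refl _))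
  -- `T g := A_{sel g}` as a homeomorphism
  let T : GL (Fin n) (v.adicCompletion F) → ((Fin (n + n) → AdeleRing (𝓞 F) F) ≃ₜ (Fin (n + n) → AdeleRing (𝓞 F) F)) :=
    fun g =>
      { toEquiv := (vDiagAct F E c hcδ hδ hd N e TV hV hVd TW hW hWd (sel g)).toEquiv
        continuous_toFun := (vDiagAct F E c hcδ hδ hd N e TV hV hVd TW hW hWd (sel g)).toLinearMap.continuous_on_pi
        continuous_invFun := (vDiagAct F E c hcδ hδ hd N e TV hV hVd TW hW hWd (sel g)).symm.toLinearMap.continuous_on_pi }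
  have heH : ∀ x, eH x = (β (evalAt F (Fin (n + n)) v x), ((placeSplitting F (Fin (n + n)) v).symm x).2) := fun x => rfl
  have hT : ∀ g, ⇑(T g) = ⇑(vDiagAct F E c hcδ hδ hd N e TV hV hVd TW hW hWd (sel g)) := fun g => rfl
  refine ⟨β, eH, T, heH, hHaar, fun x b hxb => ?_, fun g => ⟨sel g, hT g⟩, fun g x => ?_, fun g Φ hΦ => ?_, fun g x => ?_⟩
  · -- (3) `hfib`
    rw [heH]
    change (β (evalAt F (Fin (n + n)) v x)).1 ⬝ᵥ (β (evalAt F (Fin (n + n)) v x)).2 = _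
    rw [← hQ x, hxb]
    rfl
  · -- (5) `hTh`
    exact hNorm_vDiagAct F E c hcδ hδ hd N e TV hV hVd TW hW hWd (sel g) x
  · -- (6) `hTS`
    have hc : Φ ∘ ⇑(T g) = twist F (actTwistGL F (vDiagAct F E c hcδ hδ hd N e TV hV hVd TW hW hWd) (sel g)) Φ :=
      funext fun x => (twist_actTwistGL F (vDiagAct F E c hcδ hδ hd N e TV hV hVd TW hW hWd) (sel g) Φ x).symm
    rw [hc]
    exact twist_mem hΦ _
  · -- (7) `hTe`
    rw [heH, heH]
    change (β (evalAt F (Fin (n + n)) v (vDiagAct F E c hcδ hδ hd N e TV hV hVd TW hW hWd (sel g) x)),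
        ((placeSplitting F (Fin (n + n)) v).symm (vDiagAct F E c hcδ hδ hd N e TV hV hVd TW hW hWd (sel g) x)).2) = _
    rw [hii g x, hsnd g x]


include hδ in
/-- **THE SAME LETTERS IN SELECTOR FORM** (the binder shape of ★ `ThetaIntegralFibreMeasureSplitPlace` ∕ `FibreMeasureSplitPlace`):
a frame `fr := (β_v × id) ∘ placeSplitting⁻¹` with `fr x = (β_v x_v, (placeSplitting⁻¹ x).2)`, the Haar clause of `β_v`, the `hfib` core
`hNorm x = b ⇒ (fr x).1.1 ⬝ᵥ (fr x).1.2 = b`, and a SELECTOR `sel : GL_n(F_v) → U(J_V)(𝔸_F)` of `v`-supported elements with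
`hfix : A_{sel g} = id` on `X□(𝔸_F)^{(v)}` and `hTe : fr (A_{sel g} x) = ((g (fr x).1.1, (g⁻¹)ᵀ (fr x).1.2), (fr x).2)` (a choice over
★ `exists_splitPlaceFrame`). [cite: Weil1965, Chap. V n° 50, pp. 73–74] -/
theorem exists_splitPlaceSelector {s : v.adicCompletion F} (hs : s * s = algebraMap F (v.adicCompletion F) d)
    [MeasurableSpace (v.adicCompletion F)] [BorelSpace (v.adicCompletion F)]
    (μ : Measure (v.adicCompletion F)) [μ.IsAddHaarMeasure] :
    ∃ (β : (Fin (n + n) → v.adicCompletion F) ≃ₗ[v.adicCompletion F] ((Fin n → v.adicCompletion F) × (Fin n → v.adicCompletion F)))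
      (fr : (Fin (n + n) → AdeleRing (𝓞 F) F) ≃ₜ
        ((Fin n → v.adicCompletion F) × (Fin n → v.adicCompletion F)) × trivialAt F (Fin (n + n)) v)
      (sel : GL (Fin n) (v.adicCompletion F) → UnitaryGroup.adelic F E c N (TV.map (algebraMap F E))),
      (∀ x, fr x = (β (evalAt F (Fin (n + n)) v x), ((placeSplitting F (Fin (n + n)) v).symm x).2)) ∧
      (∃ cst : ℝ≥0, 0 < cst ∧
        Measure.map β (Measure.pi fun _ : Fin (n + n) => μ) =
          (cst : ℝ≥0∞) • ((Measure.pi fun _ : Fin n => μ).prod (Measure.pi fun _ : Fin n => μ))) ∧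
      (∀ (x : Fin (n + n) → AdeleRing (𝓞 F) F) (b : F),
        hNorm F E c hcδ hδ N e TV hVd TW hWd x = algebraMap F (AdeleRing (𝓞 F) F) b →
          (fr x).1.1 ⬝ᵥ (fr x).1.2 = (b : v.adicCompletion F)) ∧
      (∀ g, ∀ y ∈ trivialAt F (Fin (n + n)) v, vDiagAct F E c hcδ hδ hd N e TV hV hVd TW hW hWd (sel g) y = y) ∧
      (∀ g x, fr (vDiagAct F E c hcδ hδ hd N e TV hV hVd TW hW hWd (sel g) x) =
        ((((g : Matrix (Fin n) (Fin n) (v.adicCompletion F)) *ᵥ (fr x).1.1,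
            ((g⁻¹ : GL (Fin n) (v.adicCompletion F)) : Matrix (Fin n) (Fin n) (v.adicCompletion F))ᵀ *ᵥ (fr x).1.2) :
              (Fin n → v.adicCompletion F) × (Fin n → v.adicCompletion F)), (fr x).2)) := by
  obtain ⟨β, hQ, hHaar, hreal⟩ := exists_splitPlaceFrame F E c hcδ hδ hd N e TV hV hVd TW hW hWd v hs μ
  choose sel hfix hii hsnd using hreal
  haveI : ContinuousSMul (v.adicCompletion F) (v.adicCompletion F) := ⟨continuous_mul⟩
  let βH : (Fin (n + n) → v.adicCompletion F) ≃ₜ ((Fin n → v.adicCompletion F) × (Fin n → v.adicCompletion F)) :=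
    { toEquiv := β.toEquiv
      continuous_toFun := β.toLinearMap.continuous_on_pi
      continuous_invFun := continuous_linearEquiv_symm_prod β }
  let fr : (Fin (n + n) → AdeleRing (𝓞 F) F) ≃ₜ
      ((Fin n → v.adicCompletion F) × (Fin n → v.adicCompletion F)) × trivialAt F (Fin (n + n)) v :=
    (placeSplitting F (Fin (n + n)) v).symm.toHomeomorph.trans (βH.prodCongr (Homeomorph.refl _))
  have hfr : ∀ x, fr x = (β (evalAt F (Fin (n + n)) v x), ((placeSplitting F (Fin (n + n)) v).symm x).2) := fun x => rfl
  refine ⟨β, fr, sel, hfr, hHaar, fun x b hxb => ?_, hfix, fun g x => ?_⟩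
  · rw [hfr]
    change (β (evalAt F (Fin (n + n)) v x)).1 ⬝ᵥ (β (evalAt F (Fin (n + n)) v x)).2 = _
    rw [← hQ x, hxb]
    rfl
  · rw [hfr, hfr, hii g x, hsnd g x]

end Summit.HodgeConjecture.HodgeConjecture.Cruxes.H413.E2SWSplitPlaceLetters
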